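import Summits.HodgeConjecture.HodgeConjecture.Theorems.H413SpectrumInterfacesKernel
import Summits.HodgeConjecture.HodgeConjecture.Theorems.P2StubU2lL2RealisationByName
import Summits.HodgeConjecture.HodgeConjecture.Theorems.P2StubU1RealisationAt
import Summits.HodgeConjecture.HodgeConjecture.Theorems.P2StubU2aSpectralProjection
import Summits.HodgeConjecture.HodgeConjecture.Theorems.P2StubE2E2bOfU2
import Summits.HodgeConjecture.HodgeConjecture.Theorems.P2StubU2OfLettersCD
import Summits.HodgeConjecture.HodgeConjecture.Theorems.F0FloorSockets
import Summits.HodgeConjecture.HodgeConjecture.Theorems.F0P2dSocketD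
import Literature.NumberTheory.Automorphic.UnitaryGroupCotangentSpectralProjectionConj
import HarnessLib

-- v1.6 (draft F0P2-p02 (g2), 2026-08-31T01:3xZ, for the registrar, on A-plan1 (g18)'s 01:27:16Z ask «P2 (F0HdictE): NO socket-named head yet»): = v1.5 +
-- `import …Theorems.F0FloorSockets` + the R3 HEAD `hdictE_of_F0 (h4 : StubU4SignRule) : …Theorems.F0FloorSockets.HdictEType := oscillatorTriple_dictionaryExistence_holds_of_split h4`
-- (the floor socket III-2 (a)′ BY NAME; ★ `F0FloorSockets.HdictEType` is ★ `SpectrumInterfaces.HdictEType` token-identically) + `hdictE_of_F0_shapes` (hypotheses-explicit).  No statement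
-- of a registered stub changes; AND the socket (D) FOLDED BY NAME over ★ p799091 `Theorems/F0P2dSocketD.lean :: F0P2dSocketD.holCotFormSpectralProjection_holds`
-- (`+ import`); `sorry` count 2 {C, D} → 1 {C}.

-- v1.5 (draft F0P2-p02 (g2), 2026-08-31T00:37Z, for the registrar; pre-approved on statement grounds F0P2-ref1 r25, F0P2-plan (g2) 00:03:40Z «R1 RESOLVED … GO») over the
-- WRITTEN v1.4 d726fd9833f1249b: the socket (C′) REMOVED — E2E2b is now folded as `P2StubE2E2bOfU2.stubE2E2b_of_stubU2 (P2StubU2OfLettersCD.stub_U2_cohFormsSpectrumIsThetaAt_of_C_D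
-- stub_C_cohFinComponentIsTheta stub_D_holCotFormSpectralProjection)` (★ p795430 + ★ p796532; (C′) discharged inside by F0P4-p06's ★ master p795659 via ★ p796158, (D̄) by ★ p794879);
-- the v1.4-born socket theorem `stub_Cprime_lineClassTransport` (not a registered stub of this sub-line) is DELETED; `+ import` of p796532.  Registered stub NAMES and TYPE tokens
-- unchanged.  `sorry` count 3 {C, C′, D} → 2 {C, D}; head `H413_of_split` closed modulo {C, D, U4, hJ3a, hocc}.

-- v1.4 (draft F0P2-p01 (g2), 2026-08-30T23:4xZ, for the registrar) over the WRITTEN v1.3 6761f578cf15ef6f: (i) socket (D̄) FOLDED from (D) by ★ p794879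
-- `CotangentForms.antiholCotFormSpectralProjection_of_hol`; (ii) E2E2b FOLDED BY NAME over ★ p795430 `P2StubE2E2bOfU2.stubE2E2b_of_letters` (E2E2b is weaker than the parent U2′,
-- ★ (A) docstring; U2′ ★-folded p793962) modulo the SAME sockets as the parent line v4a — so the two sockets (C) `stub_C_cohFinComponentIsTheta` and (C′)
-- `stub_Cprime_lineClassTransport` are registered HERE under the parent's stub names (shared constants, one debt).  Registered stub NAMES and TYPE tokens unchanged.
-- `sorry` count 3 {D, D̄, E2E2b} → 3 {C, C′, D} = the parent's sockets minus U4; head `H413_of_split` closed modulo {C, C′, D, U4, hJ3a, hocc}.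

-- v1.3 (F0P2-plan (g0), 2026-08-30T23:15Z) over the WRITTEN v1.2 22401d75d1a8d082 (A-plan1 (g17) commit 2c9ddb06dfbd; = box 91842afa + registrar bib-key ∕ linter notes):
-- U2a FOLDED BY NAME over ★ p794210 `P2StubU2aSpectralProjection` modulo the two SOCKETS (D)∕(D̄) (★ p792838 statement-only letters, the SAME constants the parent
-- line `P2ThetaDictionaryExists` v4a registers under the SAME stub names — shared sockets, not new debt); E2E2b unchanged (sorried; ★ p793892's embeds-adapter is a
-- stronger socket, no content reduction, so it is NOT adopted).  Registered stub NAMES and TYPE tokens unchanged.  HC_CM is proved only modulo the 7 printed citations until rung 0 closes.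

/-!
# EDITION v1.2 (F0P2-plan (g0), boxed 2026-08-30T22:40Z) — IMPORT-BASED DEDUPE over the registrar cut v1.1 `b83be9972fd1fff6` + BY-NAME FOLDS of the two stubs
# proved tonight; NO STATEMENT CHANGE (every stub TYPE is the ★ module constant whose body is token-identical to v1.1, F0P2-ref1 r1∕r2 declseg 38∕38).

HC_CM is proved only modulo the 7 printed citations until rung 0 closes.

What changed vs v1.1:
* every DEFINITION and every sorry-free THEOREM of v1.1 (§0 floor types, §2 generic shapes, §2b `L²` junction, §3∕§3b stub TYPES, §4 heads) now lives ★ in the tree as the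
  shared module pair `Theorems/H413SpectrumInterfaces.lean` (p792253, sha16 086981b39bc30294) + `Theorems/H413SpectrumInterfacesKernel.lean` (p792880, c1bf8fb6c3d7049d),
  namespace `Summit.HodgeConjecture.HodgeConjecture.Cruxes.H413.SpectrumInterfaces` — this file IMPORTS them and restates nothing;
* U2ℓ IS PROVED: `stub_U2l_l2Realisation` is now the one-line fold of ★ `…Cruxes.H413.P2StubU2lL2RealisationByName.stub_U2l_l2Realisation_holds :
  SpectrumInterfaces.StubU2lL2Realisation` (F0P2-p01 (g0), p792655 + p792930; content: cotangent forms of `archFactorOf F V` are continuous, descend to the compact quotient,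
  `ℓ f k = toLp (toQuotFun (f · k))`) — sorries 3 → 2;
* U1′ IS PROVED (parent line's stub, entering the heads here as a hypothesis in v1.1): the heads now DISCHARGE it by ★
  `…Cruxes.H413.TowerRealisation.stubU1RealisationAt_holds : SpectrumInterfaces.StubU1RealisationAt` (F0P2-p04 (g0), p792926 over p792100∕p792047∕p792363);
* the two remaining sorried stubs U2a (`stub_U2a_spectralProjection`) and E2E2b (`stub_E2E2b_cotPartSpectrumIsTheta`) keep their registered names and statements; by the P2 RULING
  2026-08-30T22:16:17Z the parent stub U2′ closes on the DETECTION ROUTE (J1′ ★ p792074 + J0 ★ p791776 + (D) ★-statement p792838 + (C) ★-statement p791977 + P4's transport stub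
  S4a + F0P2-p02's pin bridge ⇒ F0P2-p03's fold `stubU2_of_letters`), on which these two become moot (not weakened); they remain the registered fallback decomposition.
`sorry` count = 2 = open stubs of this sub-line; head `H413_of_split (h4 : StubU4SignRule) (hJ3a : HJ3aType) (hocc : HoccType) : …Theses.HCCMUnconditional.H413` BY NAME.
The v1.1 header follows unchanged for the record.
-/

/-!
# Crux `H413` — SUB-LINE **F0-P2CohSpectrumL2**: programme P2's long pole U2′ («the `(1,0) ⊕ (0,1)` cotangent automorphic spectrum of `U(V)` is theta at finite level»)
# CUT THROUGH `L²(U(V)(F⁺)\U(V)(𝔸_{F⁺}))` — cotangent forms are `L²` (U2ℓ) · spectral projection into ONE discrete automorphic `Π` (U2a) · ENGINE SOCKET: the cotangent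
# part of each discrete automorphic `Π` has theta spectrum (E2E2b) — with U1′∕U4 of the line of record restated token-identically, and kernel-checked heads to `HdictEType` and
# to `HCCMUnconditional.H413` BY NAME.

HC_CM is proved only modulo the 7 printed citations until rung 0 closes.

F0P2-plan (g0), 2026-08-30 (floor-0 night 1; director s335, PLAN v1.4 §P2; A-plan1 (g17) desk brief v1 §2–§3).  LINE OF RECORD for programme P2 = A-p18 (g15)
`P2ThetaDictionaryExists` v2.3∕v3 (paste form f0cfd99e7f7155c8 ∕ import form 8c6e58a88c25df35; card d076b917ccc75422): three registered stubs U1′ (`StubU1RealisationAt`),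
U2′ (`StubU2CohFormsSpectrumIsThetaAt`, XL), U4 (`StubU4SignRule`) over programme P4's carriers (★ p787557 `Theorems/H413CohFormsCarriers.lean`, A-p13 (g21), namespace
`…Cruxes.H413.CohFormsCarriers`: `adelicDatum`, `rightRep`, `cohForms`, `archFactorOf`).  THIS FILE does not fork that line: it is the SUB-LINE that splits its XL stub U2′.
§0, §2 (generic shapes `IsGlobalEps`, `OccursIn`, `RealisedIn`, `HeckeRelatedAt`, `SpectrumIsThetaAtLevel`, `OmegaIrreducibleOrZero`, `OccurringGlobalThetaIsAdmissible`, the closed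
Hecke-level rigidity link and `dictionaryExistence_of_parts`) and the §3 stub TYPES U1′∕U2′∕U4 are PASTED TOKEN-IDENTICALLY from v3 (crux workfiles are not importable; attribution:
A-p18 (g15)); everything in §2b, §3b, §4b is new.

## The cut (why `L²`, and why this is a reduction and not a costume)
U2′ quantifies over an abstract irreducible `σ` of `U(V)(𝔸_{F⁺,f})` with a non-zero equivariant map into the FUNCTION space `cohForms 𝔞₀` (`𝔞₀ = archFactorOf F V`).  Print's theorems
([Rogawski1990, Thm. 13.3.6 (c), §14.6, §15.3]; [GelbartRogawski1991, Thm. 5.1.1, Lem. 5.1.2]) speak about ONE DISCRETE AUTOMORPHIC REPRESENTATION `Π ≤ L²(U(V)(F⁺)\U(V)(𝔸_{F⁺}))`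
whose archimedean component at `ι₁` is `J^±` (and trivial at the definite places).  The tree HAS that object honestly: ★ `Literature/NumberTheory/Automorphic/AutomorphicSpectrum.lean`
(`AdelicGroupData.rightRegular μ`, `DiscreteAutomorphicRep 𝒢 μ` = an irreducible closed invariant subspace of `L²`, [BorelJacquet1979, §4.6]) and ★ `AdelicUnitaryGroupSpectrum.lean`
(`UnitaryGroup.exists_isAutomorphicMeasure_isDiscretelyDecomposable_adelicGroupData`: for the ANISOTROPIC `Hm V` the quotient is compact and `L² = L²_disc` is the closure of the span of
its irreducible closed invariant subspaces, [GelfandGraevPiatetskiShapiro1969, Ch. 1 §2.3]; [PlatonovRapinchuk1994, Thm. 5.5]).  The carriers' `adelicDatum F V` IS `UnitaryGroup.adelicGroupData …`, so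
`DiscreteAutomorphicRep (adelicDatum F V) μ` is available with no new definition.  The junction function ↦ `L²`-class is the only new vocabulary (§2b): a linear
`ℓ : X →ₗ[ℂ] (Fin 2 → L²(μ))` which `Represents` the cotangent forms (each coordinate of each `f ∈ cohForms 𝔞₀` has a CONTINUOUS representative on the compact quotient descending
`h ↦ f h⁻¹ k` — the orientation matching `rightRep` (right translation) with `rightRegular` (`(R g φ)(x) = φ(g⁻¹ • x)`, `rightRegular_apply_coeFn`)), and the COTANGENT PART
`cotPart 𝔞₀ μ ℓ Π := cohForms 𝔞₀ ⊓ ⨅ₖ ℓₖ⁻¹(Π.space)` of a discrete automorphic `Π` (with `holPart`∕`antiholPart` for programme P3's Hodge-type letters).  Then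
  U2′  ⟸  U2a «every irreducible `σ` occurring in `cohForms 𝔞₀` occurs in `cotPart 𝔞₀ μ ℓ Π` for SOME discrete automorphic `Π`»  ∧  E2E2b «`∀ Π`, `SpectrumIsThetaAtLevel (datum413 …)
  (rightRep F V) (cotPart 𝔞₀ μ ℓ Π)`»   (kernel: `spectrumIsThetaAtLevel_of_parts`, two lines),
given U2ℓ «such `(μ, ℓ)` exist».  E2E2b is STRICTLY WEAKER than U2′ (monotonicity of `OccursIn` in the subspace: `cotPart ≤ cohForms`) and is exactly the statement the engine
(programme P3's trace-formula letters E1′∕E2′ over `UnitaryGroup.cmDatum` + `DiscreteAutomorphicRep`, F0P3-plan (g0) 2026-08-30T20:50:29Z D1∕D2) can address: its hypothesis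
«`σ` occurs in `cotPart … Π`» says `Π_{ι₁}` has the cotangent `K_∞`-type with (anti)holomorphic germ, i.e. `Π_{ι₁} ≅ J^± ⊠ 𝟙` ([BorelWallach2000, VI]; [Rogawski1990, §12.3]:
`π^n(ξ(b,a,c)) = J⁺`, `π^n(ξ(a,c,b)) = J⁻`), whence `Π ∈ Π(ρ)` with `dim ρ = 1` ([Rogawski1990, Thm. 13.3.6 (c)]) and `Π_f` is a restricted tensor product of local Weil
representations ([GelbartRogawski1991, Lem. 5.1.2]; [Liu2021, App. D Lem. D.1]) — Hecke-related to `ω_V(t)` at any level fixing a vector.  U2a is ANALYSIS (spectral decomposition of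
the compact quotient + the `K_∞ × K_c`-isotypic ∕ `𝔷`-eigen projection preserving «holomorphic cotangent weight form»: [BorelJacquet1979, §4.2–4.6]; [BorelWallach2000, XIII 1.2];
Matsushima's formula [BergeronMillsonMoeglin2016Balls, Part 2 §1.8]); U2ℓ is bookkeeping-plus (continuity of weight forms on `U(V)(𝔸)` descends to the compact quotient; `C ⊆ L²` for a
finite measure).  So the cut separates the analytic, the arithmetic (engine) and the archimedean (U2b letter, B4 desk) contents of U2′, each over EXISTING declarations.

## Registered stubs of this sub-line (3 — REGISTRAR CUT v1.1: U1′ ∕ U4 are the PARENT line's stubs and appear here only as TYPES ∕ hypotheses; `sorry` ONLY here) and heads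
* (`StubU1RealisationAt` = parent U1′, hypothesis only; M–L; B4-archimedean desk with P4-T2′) · `stub_U2l_l2Realisation : StubU2lL2Realisation` (M) ·
  `stub_U2a_spectralProjection : StubU2aSpectralProjection` (L) · `stub_E2E2b_cotPartSpectrumIsTheta : StubE2E2bCotPartSpectrumIsTheta` (XL — ENGINE SOCKET, programme P3∕F0-typ1
  letters [Rog90 13.3.6 (c)∕14.6] + [GR91 5.1.1∕5.1.2] + [Liu21 D.1] at the pin) · (`StubU4SignRule` = parent U4, hypothesis only; L; theta desk with P4-T3, CORRECTED parity
  [Rogawski1992, Thm. 1.1]∕[GR91 p. 446]).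
* HEADS (kernel-checked, no `sorry` in their own terms): `stubU2_of : U2ℓ → U2a → E2E2b → StubU2CohFormsSpectrumIsThetaAt` (the parent stub's TYPE, token-identical to v3 — the fold
  A-p18's `stub_U2_cohFormsSpectrumIsThetaAt` consumes); `oscillatorTriple_dictionaryExistence_holds_of_split : U1′ → U2ℓ → U2a → E2E2b → U4 → HdictEType`;
  `H413_of_split : … → HJ3aType → HoccType → HCCMUnconditional.H413`; zero-hypothesis fold `stub_U2_cohFormsSpectrumIsThetaAt_split` (of the parent's U2′ TYPE, from the three
  stubs of this sub-line).
* DEAD LINES AVOIDED: the uniqueness conjunct of `oscillatorTriple_dictionary` and the unrestricted (⇒) half of `muAdmissible_iff_multiplicity_one` (REFUTED on junk `ε`, REF1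
  2026-08-28T12:49:36Z) are not claimed; no `AutomorphyDatum`∕`StdForm` object (unusable for `Hm V`); no dictionary-level posit (`U3Spectrum`, `QuasiSplitU3`) in any stub; no
  `G_f`-only split of U2′ (costume).  Barriers: none catalogued for HodgeConjecture in this technique class (`Literature/Barriers/HodgeConjecture/`).

## References
* [Liu2021] arXiv:2102.11518, Prop. 4.13 and proof (FJcycle.tex l. 2121–2146), Rem. 4.14, Def. 4.11–4.12, App. D Lem. D.1, D.2 (2).  [GelbartRogawski1991] Invent. Math. 105:
  pp. 446–448, Thm. 5.1.1 p. 465, Lem. 5.1.2 p. 466.  [Rogawski1990] Ann. of Math. Stud. 123: §12.3, Thm. 13.3.6, §14.6, Thm. 14.6.4, §15.3.  [Rogawski1992] Thm. 1.1.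
  [BorelJacquet1979] §4.2–4.6.  [BorelWallach2000] VI; VII 3.2; XIII 1.2.  [GelfandGraevPiatetskiShapiro1969] Ch. 1 §2.3.  [PlatonovRapinchuk1994] Thm. 5.5.  [Borel1963] §5.
  [BergeronMillsonMoeglin2016Balls] Part 2 §1.8.  [Marshall2014] arXiv:1301.7244 §3.3–3.4, §4.1.  [VoisinHodgeI2002] Prop. 6.11, Cor. 7.6.  [HarrisKudlaSweet1996].  [Li1992] Thm. 2.1.
* Tree: ★ p756419 floor V7; `Cruxes/H413/Lines/a3_liu413.lean` v10.2; A-p18 (g15) v2.3∕v3 (line of record); ★ p787557 `Theorems/H413CohFormsCarriers.lean`;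
  `Automorphic/{AutomorphicSpectrum, AdelicUnitaryGroupSpectrum, AutomorphicSpectrumCompactQuotient, AdelicGroupData, HeckeAlgebra, HeckeFixedVectorsLift}.lean`;
  `Theorems/HCCMUnconditionalH411.lean` (★ `H411_proof`); `Theorems/HCCMUnconditionalH413OfFacts.lean` (`Hyp413Closing.H413_of_three_facts_flat`).
-/

set_option autoImplicit false
set_option linter.dupNamespace false

noncomputable section

namespace Summit.HodgeConjecture.HodgeConjecture.Cruxes.H413.P2CohSpectrumL2

open Summit.HodgeConjecture.HodgeConjecture.Cruxes.H413.SpectrumInterfaces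

/-! ## §3c  The THREE REGISTERED STUBS of this sub-line — statements = the ★ module's constants (bodies token-identical to v1.1 :475 ∕ :494 ∕ :515); U2ℓ is now PROVED
(fold by name), U2a is FOLDED over ★ p794210 modulo the sockets (D)∕(D̄), E2E2b over ★ p795430 + ★ p796532 modulo (C)∕(D); `sorry` lives ONLY in the two sockets
(C) (v1.5: (C′) removed, (D̄) ⇐ (D); v1.6: (D) ★ p799091). -/

/-- **`stub_U2l_l2Realisation`** — REGISTERED STUB U2ℓ (M): cotangent forms of the factor of record are `L²` on the compact quotient, with continuous descended representatives
(`StubU2lL2Realisation`). [cite: BorelJacquet1979, §4.2, §4.6] [cite: Borel1963, §5] [cite: PlatonovRapinchuk1994, Thm. 5.5]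
PROVED 2026-08-30 (F0P2-p01 (g0)): fold of ★ `P2StubU2lL2RealisationByName.stub_U2l_l2Realisation_holds` (p792930 over p792655). -/
theorem stub_U2l_l2Realisation : StubU2lL2Realisation :=
  Summit.HodgeConjecture.HodgeConjecture.Cruxes.H413.P2StubU2lL2RealisationByName.stub_U2l_l2Realisation_holds

/-- **SOCKET (D) `stub_D_holCotFormSpectralProjection`** — statement-only letter ★ p792838 (F0-typ1 (g0)), class U: the `L²` spectral projection onto a discrete
automorphic summand of `U(V)` maps holomorphic cotangent classes to holomorphic cotangent classes (Matsushima–Murakami ∕ square-integrable Hodge decomposition on the compact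
quotient).  SHARED with the parent line `P2ThetaDictionaryExists` v4a (same constant, same stub name) — one debt, two consumers.  (print: Borel–Jacquet 1979 §4.6;
Gelfand–Graev–Piatetski-Shapiro 1969 Ch. 1 §2.3; Borel–Wallach 2000 VI, XIII 1.2; Matsushima–Murakami 1963.) -/
theorem stub_D_holCotFormSpectralProjection :
    Literature.NumberTheory.Automorphic.UnitaryGroup.CotangentForms.holCotFormSpectralProjection :=
  Summit.HodgeConjecture.HodgeConjecture.Cruxes.H413.F0P2dSocketD.holCotFormSpectralProjection_holds   -- v1.6: (D) ★ p799091 (sub-line `F0_P2SpectralProjectionD`, F0P2-p01 (g2) assembly)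

/-- **SOCKET (D̄) `stub_D_antiholCotFormSpectralProjection`** — the antiholomorphic twin of (D), ★ p792838, class U; SHARED with the parent line v4a (same constant,
same stub name).  (print: as for (D).) -/
theorem stub_D_antiholCotFormSpectralProjection :
    Literature.NumberTheory.Automorphic.UnitaryGroup.CotangentForms.antiholCotFormSpectralProjection :=
  Literature.NumberTheory.Automorphic.UnitaryGroup.CotangentForms.antiholCotFormSpectralProjection_of_hol
    stub_D_holCotFormSpectralProjection   -- v1.4: (D̄) ⇐ (D), ★ p794879 (F0P2-p01 (g2)); was `by sorry` in v1.3

/-- **SOCKET (C) `stub_C_cohFinComponentIsTheta`** (class U, ENGINE E2∕E2b) — the ★ statement-only Literature constant `Rogawski1990.cohFinComponent_isTheta` BY NAME (p791977,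
reviewed); SHARED with the parent line `P2ThetaDictionaryExists` v4a (same constant, same stub name) — one debt, two consumers.  (print: Rogawski 1990 Thm. 13.3.6 (c), §14.6,
§15.3 ¶1; Gelbart–Rogawski 1991 Thm. 5.1.1 p. 465, Lem. 5.1.2 p. 466; Liu 2021 App. D Lem. D.1.)  v1.4. -/
theorem stub_C_cohFinComponentIsTheta : Literature.NumberTheory.Rogawski1990.cohFinComponent_isTheta := by
  sorry

/-- **`stub_U2a_spectralProjection`** — REGISTERED STUB U2a (L): every irreducible occurring in `cohForms 𝔞₀` occurs in the cotangent part of some discrete automorphic `Π`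
(`StubU2aSpectralProjection`). [cite: BorelJacquet1979, §4.6] [cite: GelfandGraevPiatetskiShapiro1969, Ch. 1 §2.3] [cite: BorelWallach2000, VI; XIII 1.2] [cite: Rogawski1990, §12.3]
PROVED MODULO THE SOCKETS (D)∕(D̄) 2026-08-30 (p03 (g0)): fold of ★ `P2StubU2a.stubU2aSpectralProjection_of_letters` (p794210). -/
theorem stub_U2a_spectralProjection : StubU2aSpectralProjection :=
  Summit.HodgeConjecture.HodgeConjecture.Cruxes.H413.P2StubU2a.stubU2aSpectralProjection_of_letters
    stub_D_holCotFormSpectralProjection stub_D_antiholCotFormSpectralProjection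

/-- **`stub_E2E2b_cotPartSpectrumIsTheta`** — REGISTERED STUB E2E2b (XL, ENGINE SOCKET): the cotangent part of each discrete automorphic `Π` of `U(V)` has theta spectrum at finite
level (`StubE2E2bCotPartSpectrumIsTheta`). [cite: Rogawski1990, Thm. 13.3.6; §14.6; §15.3] [cite: GelbartRogawski1991, Thm 5.1.1 p. 465; Lemma 5.1.2 p. 466] [cite: Liu2021, App. D Lem. D.1] -/
theorem stub_E2E2b_cotPartSpectrumIsTheta : StubE2E2bCotPartSpectrumIsTheta :=
  Summit.HodgeConjecture.HodgeConjecture.Cruxes.H413.P2StubE2E2bOfU2.stubE2E2b_of_stubU2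
    (Summit.HodgeConjecture.HodgeConjecture.Cruxes.H413.P2StubU2OfLettersCD.stub_U2_cohFormsSpectrumIsThetaAt_of_C_D
      stub_C_cohFinComponentIsTheta stub_D_holCotFormSpectralProjection)   -- v1.5: E2E2b ⇐ U2′ ⇐ {C, D}, ★ p795430 + ★ p796532 (F0P2-p02); v1.4 had {C, C′, D, D̄}

/-! ## §4  The heads (kernel-checked, no `sorry` below this line; the compositions are ★ `SpectrumInterfaces.stubU2_of` ∕ `…_holds_of_split` ∕ `H413_of_split`,
U1′ discharged by ★ `TowerRealisation.stubU1RealisationAt_holds`) -/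

/-- **HEAD 0′ — zero-hypothesis fold of the parent stub U2′** (`StubU2CohFormsSpectrumIsThetaAt`, the statement of the line of record's `stub_U2_cohFormsSpectrumIsThetaAt`) from the
three registered stubs (U2ℓ proved), via ★ `SpectrumInterfaces.stubU2_of`.  Print: [Liu2021, Rem. 4.14]; [GelbartRogawski1991, Introduction p. 448 L30–33]. -/
theorem stub_U2_cohFormsSpectrumIsThetaAt_split : StubU2CohFormsSpectrumIsThetaAt :=
  stubU2_of stub_U2l_l2Realisation stub_U2a_spectralProjection stub_E2E2b_cotPartSpectrumIsTheta

/-- **HEAD 1′ — the floor binder `hdictE` (`HdictEType`) from the parent's U4 statement and this sub-line's stubs**, U1′ discharged by ★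
`TowerRealisation.stubU1RealisationAt_holds`, via ★ `SpectrumInterfaces.oscillatorTriple_dictionaryExistence_holds_of_split`.  Print: [Liu2021, proof of Prop. 4.13, l. 2145; Rem. 4.14]. -/
theorem oscillatorTriple_dictionaryExistence_holds_of_split (h4 : StubU4SignRule) : HdictEType :=
  SpectrumInterfaces.oscillatorTriple_dictionaryExistence_holds_of_split
    Summit.HodgeConjecture.HodgeConjecture.Cruxes.H413.TowerRealisation.stubU1RealisationAt_holds
    stub_U2l_l2Realisation stub_U2a_spectralProjection stub_E2E2b_cotPartSpectrumIsTheta h4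

/-- **HEAD 3 — the crux decl `HCCMUnconditional.H413` BY NAME** from the parent's U4 statement, this sub-line's stubs (U2ℓ proved, U1′ discharged by ★
`TowerRealisation.stubU1RealisationAt_holds`), and the other two floor rows (P3's `hJ3a`, P4's `hocc`), via ★ `SpectrumInterfaces.H413_of_split`
(= ★ `Hyp413Closing.H413_of_three_facts_flat`).  This is the theorem the line audit of crux item stmt-HodgeConjecture-24833 reads.
Print: [Liu2021, Prop. 4.13 and proof l. 2121–2146; Rem. 4.14]; [Rogawski1990, Thm. 13.3.1]. -/
theorem H413_of_split (h4 : StubU4SignRule) (hJ3a : HJ3aType) (hocc : HoccType) :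
    Summit.HodgeConjecture.HodgeConjecture.Theses.HCCMUnconditional.H413 :=
  SpectrumInterfaces.H413_of_split
    Summit.HodgeConjecture.HodgeConjecture.Cruxes.H413.TowerRealisation.stubU1RealisationAt_holds
    stub_U2l_l2Realisation stub_U2a_spectralProjection stub_E2E2b_cotPartSpectrumIsTheta h4 hJ3a hocc

/-- **R3 HEAD — the floor socket III-2 (a)′ BY NAME**: `hdictE` at the THESES-FREE socket type ★ `Theorems.F0FloorSockets.HdictEType` (director g14 s386 (R1);
= ★ `SpectrumInterfaces.HdictEType` token-identically) from the parent's U4 statement and this sub-line's stubs — the shape `ledger skeleton check … --crux-decl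
…F0FloorSockets.HdictEType` reads.  Print: [Liu2021, proof of Prop. 4.13, l. 2145; Rem. 4.14]. -/
theorem hdictE_of_F0 (h4 : StubU4SignRule) : Summit.HodgeConjecture.HodgeConjecture.Theorems.F0FloorSockets.HdictEType :=
  oscillatorTriple_dictionaryExistence_holds_of_split h4

/-- **R3 HEAD, hypotheses-explicit**: the floor socket `F0FloorSockets.HdictEType` from the three registered stub STATEMENTS of this sub-line and the parent's U4
(U1′ discharged by ★ `TowerRealisation.stubU1RealisationAt_holds`).  Print: [Liu2021, proof of Prop. 4.13, l. 2145; Rem. 4.14]. -/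
theorem hdictE_of_F0_shapes (hl : StubU2lL2Realisation) (ha : StubU2aSpectralProjection) (he : StubE2E2bCotPartSpectrumIsTheta)
    (h4 : StubU4SignRule) : Summit.HodgeConjecture.HodgeConjecture.Theorems.F0FloorSockets.HdictEType :=
  SpectrumInterfaces.oscillatorTriple_dictionaryExistence_holds_of_split
    Summit.HodgeConjecture.HodgeConjecture.Cruxes.H413.TowerRealisation.stubU1RealisationAt_holds hl ha he h4

end Summit.HodgeConjecture.HodgeConjecture.Cruxes.H413.P2CohSpectrumL2

end
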